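import Mathlib
import HarnessLib
import Summits.HubbardSuperconductivity.HubbardSuperconductivity.Theorems.KLProgrammeKLRegimeEngineTwoLegStepV17FDoor
import Summits.HubbardSuperconductivity.HubbardSuperconductivity.Theorems.KLProgrammeKLRegimeVolumeLimitFlowFrames

/-!
# K3 gen 7-flow, ENGINE child `KLRegimeEngineV17F` (stmt-HubbardSuperconductivity-20368), stub (e)/(M) rows C1/C2: the NESTED LEGS AT ALL SCALES FROM A
# ONE-STEP COMPARISON AT COMPARABLE FRAMES (strong induction on the scale; the F-specific frame-comparability input is DERIVED, not asked)

Cell gate-hubbard-kl, seat hubbard-kl-r2d-p1 (g5).  Sequel of `…EngineTwoLegStepV17FDoor{,Pkg}` (p526027/p526589).  Under scheme F the two nested legs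
of (E3f-F) (`twoLegVolumeRateF_of_nestedLegs_quarter`, rows C1/C2 of HOME/hubbard-kl-r2d-p1/RESIDUAL-TABLE-e-V17F.md) compare the scale-`n` readings
of two volumes EACH AT ITS OWN FLOW FRAME, `ν_n^{(1)}(K_n^{(1)})` vs `ν_n^{(2)}(K_n^{(2)})`.  An analytic one-step comparison needs the two frames to be close;
by k3c5-p3's telescoping (`TwoPointAssembly.abs_eval_klFlowFrameU_sub_le_sum` + `abs_eval_klFlowPieceJackson_sub_le`, …VolumeLimitFlowFrames: Jackson mean
and tube extension are 1-Lipschitz in the sup norm) `|K_n^{(1)}(q) − K_n^{(2)}(q)| ≤ Σ_{m<n} sup_θ|ν_m^{(1)} − ν_m^{(2)}|` — the SAME leg at the lower scales.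
Hence the leg at all scales follows from the ONE-STEP statement by strong induction, and the leg supplier owes only:

  STEP(n): thresholds + the two per-volume histories below `n` (`histV17F ∧ TwoLegSlopes`, as in the door) + the leg's OWN rates at every `m < n`
  + the frame comparability `|K_n^{(1)}(q) − K_n^{(2)}(q)| ≤ (Σ_{m<n} a m)/L₁` ⇒ the rate `a n / L₁` at scale `n`.

* `cutLeg_allScales_of_step` — CUTOFF leg (`L₁` fixed, `M₁ ≤ M₂`): STEP for every `n ≤ N` ⇒ the door's `hcut` shape for every `n ≤ N` with bound `a n / L₁`;
* `spLeg_allScales_of_step` — SPATIAL nested leg (`L₁ ∣ L₂`, common cutoff `M₂`): the same;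
* `_quarter` forms at `a n := Q.CL β n / 4` — literally the `hcut`/`hsp` hypotheses of `twoLegStepV17F_of_jets_slopes_nestedLegs` / `…_of_jets_sepTubeGradient_nestedLegs[_pkg]`.

Proofs only (induction + the two cited lemmas); no definitions; nothing about the model is asserted; nothing asserts superconductivity.
[cite: BenfattoGiulianiMastropietro2006] (§2.4 (2.23): the flowing dispersion); KL STATUS 2026-08-27 l.2548 (ruling F), (K3F) Q-F4.
-/

noncomputable section

namespace Summit.HubbardSuperconductivity.HubbardSuperconductivity.Theorems.EngineV8

set_option linter.dupNamespace false -- summit = problem name (single-conjunct summit), D-0017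

open Real Finset Literature.MathematicalPhysics.QuantumLattice Literature.Probability.LatticeModels
open Literature.MathematicalPhysics.QuantumLattice.FermiRG
open Summit.HubbardSuperconductivity.HubbardSuperconductivity.Theorems.KLProgrammeLegKernels
open Summit.HubbardSuperconductivity.HubbardSuperconductivity.Theorems.DispersionFlow
open Summit.HubbardSuperconductivity.HubbardSuperconductivity.Theorems.KLRegimeSplit
open Summit.HubbardSuperconductivity.HubbardSuperconductivity.Theorems.TwoPointAssembly

section Legs

variable {L : ℕ} {G : GeoConsts} {P : SplitConsts} {Q : EngConsts} {R : RenConsts} {β U μ : ℝ}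

/-- **Frame comparability of two volumes at scale `n` from the rates below `n`** (the form the steps consume): if for every `m < n` the scale-`m` readings
of `(L₁, M₁)` and `(L₂, M₂)` are `C⁴` (here: from `histV17F`'s (E3a-F) slot) and within `a m / L₁`, then `|K_n^{(1)}(q) − K_n^{(2)}(q)| ≤ (Σ_{m<n} a m)/L₁`. -/
theorem abs_eval_klFlowFrameU_sub_le_of_rates {L₁ M₁ L₂ M₂ : ℕ} [NeZero L₁] [NeZero M₁] [NeZero L₂] [NeZero M₂] (hμ : μ ∈ klWindowC) {n : ℕ}
    {a : ℕ → ℝ}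
    (h₁ : ∀ j < n, histV17F L₁ M₁ G P Q R β U μ j) (h₂ : ∀ j < n, histV17F L₂ M₂ G P Q R β U μ j)
    (hrates : ∀ m < n, ∀ θ : ℝ, |klLocalPart L₁ M₁ β U μ (klFlowFrameU L₁ M₁ β U μ m) m θ -
      klLocalPart L₂ M₂ β U μ (klFlowFrameU L₂ M₂ β U μ m) m θ| ≤ a m / L₁) (q : Fin 2 → ℝ) :
    |(klFlowFrameU L₁ M₁ β U μ n).eval q - (klFlowFrameU L₂ M₂ β U μ n).eval q| ≤ (∑ m ∈ range n, a m) / L₁ := by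
  rw [Finset.sum_div]
  exact abs_eval_klFlowFrameU_sub_le_sum β U μ n q fun m hm =>
    abs_eval_klFlowPieceJackson_sub_le hμ m (h₁ m hm).2.2.2.1 (h₂ m hm).2.2.2.1 (hrates m hm) q

/-- **CUTOFF LEG AT ALL SCALES FROM THE ONE-STEP COMPARISON** (strong induction on `n ≤ N`).  STEP: at scale `n ≤ N`, for `L ≤ L₁`, `M₁ ≤ M₂` above the
thresholds `Q.M0 β L₁`, `Mq L₁`, given the two histories below `n`, the leg's own rates `a m / L₁` at every `m < n` and the frame comparability
`|K_n^{(L₁,M₁)}(q) − K_n^{(L₁,M₂)}(q)| ≤ (Σ_{m<n} a m)/L₁`, the scale-`n` readings differ by `≤ a n / L₁`.  CONCLUSION: the door's `hcut` shape at every `n ≤ N`. -/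
theorem cutLeg_allScales_of_step (hμ : μ ∈ klWindowC) {N : ℕ} {a : ℕ → ℝ}
    (hstep : ∀ n ≤ N, ∀ (Mq : ℕ → ℕ) (L₁ M₁ M₂ : ℕ) [NeZero L₁] [NeZero M₁] [NeZero M₂], L ≤ L₁ → Q.M0 β L₁ ≤ M₁ → Mq L₁ ≤ M₁ → M₁ ≤ M₂ →
      (∀ j < n, histV17F L₁ M₁ G P Q R β U μ j ∧ TwoLegSlopes L₁ M₁ R β U μ (klFlowFrameU L₁ M₁ β U μ j) j) →
      (∀ j < n, histV17F L₁ M₂ G P Q R β U μ j ∧ TwoLegSlopes L₁ M₂ R β U μ (klFlowFrameU L₁ M₂ β U μ j) j) →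
      (∀ m < n, ∀ θ : ℝ, |klLocalPart L₁ M₁ β U μ (klFlowFrameU L₁ M₁ β U μ m) m θ -
        klLocalPart L₁ M₂ β U μ (klFlowFrameU L₁ M₂ β U μ m) m θ| ≤ a m / L₁) →
      (∀ q : Fin 2 → ℝ, |(klFlowFrameU L₁ M₁ β U μ n).eval q - (klFlowFrameU L₁ M₂ β U μ n).eval q| ≤ (∑ m ∈ range n, a m) / L₁) →
        ∀ θ : ℝ, |klLocalPart L₁ M₁ β U μ (klFlowFrameU L₁ M₁ β U μ n) n θ -
          klLocalPart L₁ M₂ β U μ (klFlowFrameU L₁ M₂ β U μ n) n θ| ≤ a n / L₁) :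
    ∀ n ≤ N, ∀ (Mq : ℕ → ℕ) (L₁ M₁ M₂ : ℕ) [NeZero L₁] [NeZero M₁] [NeZero M₂], L ≤ L₁ → Q.M0 β L₁ ≤ M₁ → Mq L₁ ≤ M₁ → M₁ ≤ M₂ →
      (∀ j < n, histV17F L₁ M₁ G P Q R β U μ j ∧ TwoLegSlopes L₁ M₁ R β U μ (klFlowFrameU L₁ M₁ β U μ j) j) →
      (∀ j < n, histV17F L₁ M₂ G P Q R β U μ j ∧ TwoLegSlopes L₁ M₂ R β U μ (klFlowFrameU L₁ M₂ β U μ j) j) →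
        ∀ θ : ℝ, |klLocalPart L₁ M₁ β U μ (klFlowFrameU L₁ M₁ β U μ n) n θ -
          klLocalPart L₁ M₂ β U μ (klFlowFrameU L₁ M₂ β U μ n) n θ| ≤ a n / L₁ := by
  intro n
  induction n using Nat.strong_induction_on with
  | _ n ih =>
    intro hn Mq L₁ M₁ M₂ _ _ _ hL hM hMq hM₁₂ hh₁ hh₂
    have hrates : ∀ m < n, ∀ θ : ℝ, |klLocalPart L₁ M₁ β U μ (klFlowFrameU L₁ M₁ β U μ m) m θ -
        klLocalPart L₁ M₂ β U μ (klFlowFrameU L₁ M₂ β U μ m) m θ| ≤ a m / L₁ := fun m hm =>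
      ih m hm (by omega) Mq L₁ M₁ M₂ hL hM hMq hM₁₂ (fun j hj => hh₁ j (hj.trans hm)) (fun j hj => hh₂ j (hj.trans hm))
    have hframe := abs_eval_klFlowFrameU_sub_le_of_rates (L₁ := L₁) (M₁ := M₁) (L₂ := L₁) (M₂ := M₂) hμ
      (fun j hj => (hh₁ j hj).1) (fun j hj => (hh₂ j hj).1) hrates
    exact hstep n hn Mq L₁ M₁ M₂ hL hM hMq hM₁₂ hh₁ hh₂ hrates hframe

/-- **SPATIAL NESTED LEG AT ALL SCALES FROM THE ONE-STEP COMPARISON** (`L ≤ L₁ ∣ L₂`, common cutoff `M₂` above both volumes' thresholds): as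
`cutLeg_allScales_of_step`, for the door's `hsp` shape. -/
theorem spLeg_allScales_of_step (hμ : μ ∈ klWindowC) {N : ℕ} {a : ℕ → ℝ}
    (hstep : ∀ n ≤ N, ∀ (Mq : ℕ → ℕ) (L₁ L₂ M₂ : ℕ) [NeZero L₁] [NeZero L₂] [NeZero M₂], L ≤ L₁ → L₁ ∣ L₂ → Q.M0 β L₁ ≤ M₂ → Mq L₁ ≤ M₂ →
      Q.M0 β L₂ ≤ M₂ → Mq L₂ ≤ M₂ →
      (∀ j < n, histV17F L₁ M₂ G P Q R β U μ j ∧ TwoLegSlopes L₁ M₂ R β U μ (klFlowFrameU L₁ M₂ β U μ j) j) →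
      (∀ j < n, histV17F L₂ M₂ G P Q R β U μ j ∧ TwoLegSlopes L₂ M₂ R β U μ (klFlowFrameU L₂ M₂ β U μ j) j) →
      (∀ m < n, ∀ θ : ℝ, |klLocalPart L₁ M₂ β U μ (klFlowFrameU L₁ M₂ β U μ m) m θ -
        klLocalPart L₂ M₂ β U μ (klFlowFrameU L₂ M₂ β U μ m) m θ| ≤ a m / L₁) →
      (∀ q : Fin 2 → ℝ, |(klFlowFrameU L₁ M₂ β U μ n).eval q - (klFlowFrameU L₂ M₂ β U μ n).eval q| ≤ (∑ m ∈ range n, a m) / L₁) →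
        ∀ θ : ℝ, |klLocalPart L₁ M₂ β U μ (klFlowFrameU L₁ M₂ β U μ n) n θ -
          klLocalPart L₂ M₂ β U μ (klFlowFrameU L₂ M₂ β U μ n) n θ| ≤ a n / L₁) :
    ∀ n ≤ N, ∀ (Mq : ℕ → ℕ) (L₁ L₂ M₂ : ℕ) [NeZero L₁] [NeZero L₂] [NeZero M₂], L ≤ L₁ → L₁ ∣ L₂ → Q.M0 β L₁ ≤ M₂ → Mq L₁ ≤ M₂ →
      Q.M0 β L₂ ≤ M₂ → Mq L₂ ≤ M₂ →
      (∀ j < n, histV17F L₁ M₂ G P Q R β U μ j ∧ TwoLegSlopes L₁ M₂ R β U μ (klFlowFrameU L₁ M₂ β U μ j) j) →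
      (∀ j < n, histV17F L₂ M₂ G P Q R β U μ j ∧ TwoLegSlopes L₂ M₂ R β U μ (klFlowFrameU L₂ M₂ β U μ j) j) →
        ∀ θ : ℝ, |klLocalPart L₁ M₂ β U μ (klFlowFrameU L₁ M₂ β U μ n) n θ -
          klLocalPart L₂ M₂ β U μ (klFlowFrameU L₂ M₂ β U μ n) n θ| ≤ a n / L₁ := by
  intro n
  induction n using Nat.strong_induction_on with
  | _ n ih =>
    intro hn Mq L₁ L₂ M₂ _ _ _ hL hdvd hM₁ hMq₁ hM₂ hMq₂ hh₁ hh₂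
    have hrates : ∀ m < n, ∀ θ : ℝ, |klLocalPart L₁ M₂ β U μ (klFlowFrameU L₁ M₂ β U μ m) m θ -
        klLocalPart L₂ M₂ β U μ (klFlowFrameU L₂ M₂ β U μ m) m θ| ≤ a m / L₁ := fun m hm =>
      ih m hm (by omega) Mq L₁ L₂ M₂ hL hdvd hM₁ hMq₁ hM₂ hMq₂ (fun j hj => hh₁ j (hj.trans hm)) (fun j hj => hh₂ j (hj.trans hm))
    have hframe := abs_eval_klFlowFrameU_sub_le_of_rates (L₁ := L₁) (M₁ := M₂) (L₂ := L₂) (M₂ := M₂) hμ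
      (fun j hj => (hh₁ j hj).1) (fun j hj => (hh₂ j hj).1) hrates
    exact hstep n hn Mq L₁ L₂ M₂ hL hdvd hM₁ hMq₁ hM₂ hMq₂ hh₁ hh₂ hrates hframe

/-- **The cutoff leg at the quarter budget** `a n := Q.CL β n / 4` — the conclusion is literally the door's `hcut` at every `n ≤ N`. -/
theorem cutLeg_allScales_of_step_quarter (hμ : μ ∈ klWindowC) {N : ℕ}
    (hstep : ∀ n ≤ N, ∀ (Mq : ℕ → ℕ) (L₁ M₁ M₂ : ℕ) [NeZero L₁] [NeZero M₁] [NeZero M₂], L ≤ L₁ → Q.M0 β L₁ ≤ M₁ → Mq L₁ ≤ M₁ → M₁ ≤ M₂ →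
      (∀ j < n, histV17F L₁ M₁ G P Q R β U μ j ∧ TwoLegSlopes L₁ M₁ R β U μ (klFlowFrameU L₁ M₁ β U μ j) j) →
      (∀ j < n, histV17F L₁ M₂ G P Q R β U μ j ∧ TwoLegSlopes L₁ M₂ R β U μ (klFlowFrameU L₁ M₂ β U μ j) j) →
      (∀ m < n, ∀ θ : ℝ, |klLocalPart L₁ M₁ β U μ (klFlowFrameU L₁ M₁ β U μ m) m θ -
        klLocalPart L₁ M₂ β U μ (klFlowFrameU L₁ M₂ β U μ m) m θ| ≤ Q.CL β m / 4 / L₁) →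
      (∀ q : Fin 2 → ℝ, |(klFlowFrameU L₁ M₁ β U μ n).eval q - (klFlowFrameU L₁ M₂ β U μ n).eval q| ≤
        (∑ m ∈ range n, Q.CL β m / 4) / L₁) →
        ∀ θ : ℝ, |klLocalPart L₁ M₁ β U μ (klFlowFrameU L₁ M₁ β U μ n) n θ -
          klLocalPart L₁ M₂ β U μ (klFlowFrameU L₁ M₂ β U μ n) n θ| ≤ Q.CL β n / 4 / L₁)
    {n : ℕ} (hn : n ≤ N) :
    ∀ (Mq : ℕ → ℕ) (L₁ M₁ M₂ : ℕ) [NeZero L₁] [NeZero M₁] [NeZero M₂], L ≤ L₁ → Q.M0 β L₁ ≤ M₁ → Mq L₁ ≤ M₁ → M₁ ≤ M₂ →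
      (∀ j < n, histV17F L₁ M₁ G P Q R β U μ j ∧ TwoLegSlopes L₁ M₁ R β U μ (klFlowFrameU L₁ M₁ β U μ j) j) →
      (∀ j < n, histV17F L₁ M₂ G P Q R β U μ j ∧ TwoLegSlopes L₁ M₂ R β U μ (klFlowFrameU L₁ M₂ β U μ j) j) →
        ∀ θ : ℝ, |klLocalPart L₁ M₁ β U μ (klFlowFrameU L₁ M₁ β U μ n) n θ -
          klLocalPart L₁ M₂ β U μ (klFlowFrameU L₁ M₂ β U μ n) n θ| ≤ Q.CL β n / 4 / L₁ :=
  cutLeg_allScales_of_step (a := fun n => Q.CL β n / 4) hμ hstep n hn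

/-- **The spatial nested leg at the quarter budget** — the conclusion is literally the door's `hsp` at every `n ≤ N`. -/
theorem spLeg_allScales_of_step_quarter (hμ : μ ∈ klWindowC) {N : ℕ}
    (hstep : ∀ n ≤ N, ∀ (Mq : ℕ → ℕ) (L₁ L₂ M₂ : ℕ) [NeZero L₁] [NeZero L₂] [NeZero M₂], L ≤ L₁ → L₁ ∣ L₂ → Q.M0 β L₁ ≤ M₂ → Mq L₁ ≤ M₂ →
      Q.M0 β L₂ ≤ M₂ → Mq L₂ ≤ M₂ →
      (∀ j < n, histV17F L₁ M₂ G P Q R β U μ j ∧ TwoLegSlopes L₁ M₂ R β U μ (klFlowFrameU L₁ M₂ β U μ j) j) →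
      (∀ j < n, histV17F L₂ M₂ G P Q R β U μ j ∧ TwoLegSlopes L₂ M₂ R β U μ (klFlowFrameU L₂ M₂ β U μ j) j) →
      (∀ m < n, ∀ θ : ℝ, |klLocalPart L₁ M₂ β U μ (klFlowFrameU L₁ M₂ β U μ m) m θ -
        klLocalPart L₂ M₂ β U μ (klFlowFrameU L₂ M₂ β U μ m) m θ| ≤ Q.CL β m / 4 / L₁) →
      (∀ q : Fin 2 → ℝ, |(klFlowFrameU L₁ M₂ β U μ n).eval q - (klFlowFrameU L₂ M₂ β U μ n).eval q| ≤
        (∑ m ∈ range n, Q.CL β m / 4) / L₁) →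
        ∀ θ : ℝ, |klLocalPart L₁ M₂ β U μ (klFlowFrameU L₁ M₂ β U μ n) n θ -
          klLocalPart L₂ M₂ β U μ (klFlowFrameU L₂ M₂ β U μ n) n θ| ≤ Q.CL β n / 4 / L₁)
    {n : ℕ} (hn : n ≤ N) :
    ∀ (Mq : ℕ → ℕ) (L₁ L₂ M₂ : ℕ) [NeZero L₁] [NeZero L₂] [NeZero M₂], L ≤ L₁ → L₁ ∣ L₂ → Q.M0 β L₁ ≤ M₂ → Mq L₁ ≤ M₂ →
      Q.M0 β L₂ ≤ M₂ → Mq L₂ ≤ M₂ →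
      (∀ j < n, histV17F L₁ M₂ G P Q R β U μ j ∧ TwoLegSlopes L₁ M₂ R β U μ (klFlowFrameU L₁ M₂ β U μ j) j) →
      (∀ j < n, histV17F L₂ M₂ G P Q R β U μ j ∧ TwoLegSlopes L₂ M₂ R β U μ (klFlowFrameU L₂ M₂ β U μ j) j) →
        ∀ θ : ℝ, |klLocalPart L₁ M₂ β U μ (klFlowFrameU L₁ M₂ β U μ n) n θ -
          klLocalPart L₂ M₂ β U μ (klFlowFrameU L₂ M₂ β U μ n) n θ| ≤ Q.CL β n / 4 / L₁ :=
  spLeg_allScales_of_step (a := fun n => Q.CL β n / 4) hμ hstep n hn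

end Legs

end Summit.HubbardSuperconductivity.HubbardSuperconductivity.Theorems.EngineV8

end
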